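import Summits.MatrixMultiplication.OmegaCensus.STPP222CubeProdEnc

/-!
# ω-census, `(2,2,2)³` in `ZMod 3 × ZMod 9` — the code list (data shared by the search parts)

HONEST FRAMING (pub-omega census; verbatim): lottery ticket; floor = certified bounds/negative ranges.
Census STRUCTURE bookkeeping (question Q7, row `k = 3`), not progress on `ω`.  Generated by ENG2 gen 18's `prodgen3.py`.
-/

namespace Summit.MatrixMultiplication.OmegaCensus

namespace STPP222CubeNeg

/-- The slot-padded encoding of `ZMod 3 × ZMod 9` (slot widths [7]). -/
def E3_9 : Enc3 (ZMod 3 × ZMod 9) :=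
  (prodEnc3 (zEnc 3) (zEnc 9) 7 (by decide))

/-- All codes of `ZMod 3 × ZMod 9` under the padded encoding, increasing (data). -/
def el3_9 : List ℕ :=
  [0, 1, 2, 3, 4, 5, 6, 7, 8, 128, 129, 130, 131, 132, 133, 134, 135, 136, 256, 257, 258, 259, 260, 261, 262, 263,
    264]

end STPP222CubeNeg

end Summit.MatrixMultiplication.OmegaCensus
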